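import Summits.ResolutionOfSingularities.ResolutionOfSingularities.Theorems.InvariantDescentLU2
import Mathlib.LinearAlgebra.Lagrange
import HarnessLib

/-!
# InvariantDescentLU3 (lens numbering: InvariantDescentLU part 2/2 = FILE 10) — the invariant descent is UNRAMIFIED: `𝔪_{(T₁)_𝔪′} = 𝔪_{(T₁ ∩ K)_𝔪} · (T₁)_𝔪′`
(ENGINE-2⁺ of NEXT-g29-C STEP 1, sub-lemma (1a); decomp-res lens-1 g28 preparation C, part 2)

Same frame as part 1 (`Theorems.InvariantDescentLU`): `H` a finite set of automorphisms of the field `E` closed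
under composition with `1 ∈ H`, `K = E^H`, `T₁ ⊆ O_E` an `H`-stable subring, `x ∈ T₁` a separating witness
(`v(x − h x) = 0` for `h ≠ 1`) with `E = K[x]`; HERE MOREOVER `O_E` is `H`-STABLE (`z ∈ O_E ↔ h z ∈ O_E`: the
centre does not split — automatic when the whole Galois group fixes the valuation ring upstairs, critic row 215
(A1)).  Conclusion (`exists_sum_of_valuation_lt_one`, `maximalIdeal_locAtCentre_eq_map`): every element of the
local ring `(T₁)_𝔪′` of value `< 1` is a `(T₁)_𝔪′`-linear combination of elements of value `< 1` of the
INVARIANT local ring `(T₁ ∩ K)_𝔪`, i.e. the maximal ideal upstairs is extended from downstairs.  With part 1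
(regularity of `(T₁ ∩ K)_𝔪`) this says: a regular system of parameters of the invariant local ring IS a regular
system of parameters upstairs — the form in which g29 uses it (parameters of `B` lying in a fixed field).

Mechanism (no residue fields, no minimal polynomials): LAGRANGE INTERPOLATION at the nodes `h x`, `h ∈ H`
(pairwise differences are units of `O_E` by separation + stability).  For `a ∈ T₁` write `a = R(x)` with
`R ∈ K[X]` of degree `< |H|` (reduce a `K`-polynomial expression modulo the characteristic polynomial
`∏_h (X − h x)`); then `R = ∑_h R(h x) · ℓ_h` (Mathlib `Lagrange.eq_interpolate`) with `R(h x) = h(a)` and the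
Lagrange basis `ℓ_h` having coefficients in `(T₁)_𝔪′`; so each coefficient `r_i` of `R` lies in `(T₁)_𝔪′`,
has value `< 1` when `v(a) < 1` (ultrametric inequality; `v(h a) < 1` by stability), and is `H`-fixed, hence
lies in `(T₁ ∩ K)_𝔪` by part 1's norm trick `mem_locAtCentre_inf_of_fixed`; finally `a = ∑ r_i x^i`.
(Sources: folklore; Lagrange interpolation as in any algebra text, via Mathlib `Mathlib.LinearAlgebra.Lagrange`.)

WRITER NOTE (decomp-res writer g13): this is the lens's FILE 10 `land/InvariantDescentLU2.lean` (sha256 3faa4156,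
295 l; HOME/decomp-res-lens-1/g28,
WRITER-E.md; critic letter row 218c «ENGINE-2⁺ part 2 VALID TOOL, LANDABLE AT 0»). It lands as
`Theorems/InvariantDescentLU3.lean` because the tree name
`InvariantDescentLU2` is already taken by the second half of FILE 9 (the writer split the 607-line FILE 9 into
`InvariantDescentLU` + `InvariantDescentLU2`
at the 400-line cap); accordingly the first import is `…Theorems.InvariantDescentLU2` (= the end of FILE 9) instead
of `…Theorems.InvariantDescentLU`.
Namespace, the Lagrange import and every declaration are VERBATIM; `--supports stmt-ResolutionOfSingularities-0641 --as helper`.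
-/

open Polynomial Literature.AlgebraicGeometry.Resolution
open Summit.ResolutionOfSingularities.ResolutionOfSingularities.Theorems.InertDescentLU

namespace Summit.ResolutionOfSingularities.ResolutionOfSingularities.Theorems.InvariantDescentLU

universe u

variable {E : Type u} [Field E] (OE : ValuationSubring E)

/-! ### S7. Polynomial bookkeeping: fixed coefficients, reduction modulo the characteristic polynomial -/

section PolyFixed

variable (H : Finset (E ≃+* E))

/-- An automorphism fixing the coefficients of `p` commutes with evaluation: `h (p(z)) = p(h z)`. [folklore] -/
theorem apply_eval_of_coeff_fixed (h : E ≃+* E) {p : E[X]} (hp : ∀ i, h (p.coeff i) = p.coeff i)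
    (z : E) : h (p.eval z) = p.eval (h z) := by
  have hmap : p.map (h : E →+* E) = p := by
    ext i
    rw [coeff_map]
    exact hp i
  have := Polynomial.hom_eval₂ p (RingHom.id E) (h : E →+* E) z
  rw [eval₂_eq_eval_map, Polynomial.map_id] at this
  change h (p.eval z) = _ at this
  rw [this, eval₂_eq_eval_map, RingHom.comp_id, hmap]
  rfl

/-- The characteristic polynomial has degree `|H|`. [folklore] -/
theorem natDegree_charPoly (t : E) : (charPoly H t).natDegree = H.card := by
  rw [charPoly, natDegree_prod_of_monic _ _ fun h _ => monic_X_sub_C (h t)]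
  simp

/-- **Reduction modulo the characteristic polynomial.** If `z = p(x)` for a polynomial `p` with `H`-fixed
coefficients, then `z = R(x)` with `R` of degree `< |H|` and `H`-fixed coefficients (`R = p mod ∏_h (X − h x)`).
[folklore] -/
theorem exists_eval_eq_of_degree_lt (h1 : (1 : E ≃+* E) ∈ H) (hmul : ∀ g ∈ H, ∀ h ∈ H, g * h ∈ H)
    (x : E) {p : E[X]} (hp : ∀ h ∈ H, ∀ i, h (p.coeff i) = p.coeff i) :
    ∃ R : E[X], R.degree < H.card ∧ (∀ h ∈ H, ∀ i, h (R.coeff i) = R.coeff i) ∧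
      R.eval x = p.eval x := by
  have hfm : (charPoly H x).Monic := charPoly_monic H x
  refine ⟨p %ₘ charPoly H x, ?_, ?_, ?_⟩
  · have hlt := degree_modByMonic_lt p hfm
    rwa [degree_eq_natDegree hfm.ne_zero, natDegree_charPoly] at hlt
  · intro h hh i
    have hpm : p.map (h : E →+* E) = p := by
      ext j
      rw [coeff_map]
      exact hp h hh j
    have e := Polynomial.map_modByMonic (h : E →+* E) (p := p) hfm
    rw [hpm, charPoly_map_eq H hmul hh x] at e
    have := congrArg (fun q : E[X] => q.coeff i) e
    simpa [coeff_map] using this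
  · have e := modByMonic_add_div p (charPoly H x)
    have := congrArg (fun q : E[X] => q.eval x) e
    simp only [eval_add, eval_mul, charPoly_eval_self H h1 x, zero_mul, add_zero] at this
    exact this

end PolyFixed

/-! ### S8. Lagrange interpolation at the conjugates of the witness -/

section Lagrange

variable {H : Finset (E ≃+* E)} {T₁ : Subring E}

/-- Under stability of `O_E`, an automorphism maps non-units of `O_E` to non-units. [folklore] -/
theorem valuation_apply_lt_one {h : E ≃+* E} (hHO : ∀ z : E, z ∈ OE ↔ h z ∈ OE) {a : E}
    (ha : OE.valuation a < 1) : OE.valuation (h a) < 1 := by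
  have haO : a ∈ OE := (OE.valuation_le_one_iff _).mp ha.le
  have hhaO : OE.valuation (h a) ≤ 1 := (OE.valuation_le_one_iff _).mpr ((hHO _).mp haO)
  refine lt_of_le_of_ne hhaO fun heq => ?_
  have hha0 : h a ≠ 0 := ne_zero_of_valuation_eq_one heq
  have ha0 : a ≠ 0 := fun e => hha0 (by rw [e, map_zero])
  -- `(h a)⁻¹ = h (a⁻¹) ∈ O_E`, hence `a⁻¹ ∈ O_E`, contradicting `v(a) < 1`
  have hinvO : (h a)⁻¹ ∈ OE := by
    rw [← OE.valuation_le_one_iff, map_inv₀, heq, inv_one]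
  have hainvO : a⁻¹ ∈ OE := (hHO _).mpr (by rwa [map_inv₀])
  have hle := (OE.valuation_le_one_iff _).mpr hainvO
  rw [map_inv₀] at hle
  have h1 : (1 : _) ≤ OE.valuation a := by
    have hva0 : OE.valuation a ≠ 0 := (Valuation.ne_zero_iff _).mpr ha0
    calc (1 : _) = (OE.valuation a)⁻¹ * OE.valuation a := by rw [inv_mul_cancel₀ hva0]
      _ ≤ 1 * OE.valuation a := mul_le_mul' hle le_rfl
      _ = OE.valuation a := one_mul _
  exact absurd ha (not_lt.mpr h1)

/-- The nodes `h x`, `h ∈ H`, are pairwise distinct with UNIT differences, under separation and stability.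
[folklore] -/
theorem valuation_sub_nodes_eq_one (h1 : (1 : E ≃+* E) ∈ H) (hmul : ∀ g ∈ H, ∀ h ∈ H, g * h ∈ H)
    (hHO : ∀ h ∈ H, ∀ z : E, z ∈ OE ↔ h z ∈ OE) {x : E}
    (hsep : ∀ h ∈ H, h ≠ 1 → OE.valuation (x - h x) = 1)
    {g h : E ≃+* E} (hg : g ∈ H) (hh : h ∈ H) (hne : g ≠ h) :
    OE.valuation (g x - h x) = 1 := by
  have hginv : g⁻¹ ∈ H := inv_mem H h1 hmul hg
  have hk : g⁻¹ * h ∈ H := hmul _ hginv _ hh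
  have hk1 : g⁻¹ * h ≠ 1 := by
    intro e
    apply hne
    have : g * (g⁻¹ * h) = g * 1 := by rw [e]
    rwa [← mul_assoc, mul_inv_cancel, one_mul, mul_one, eq_comm] at this
  have e : g x - h x = g (x - (g⁻¹ * h) x) := by
    rw [map_sub, RingAut.mul_apply]
    show g x - h x = g x - (g * g⁻¹) (h x)
    rw [mul_inv_cancel]; rfl
  rw [e]
  exact valuation_apply_eq_one OE (hHO g hg) (hsep _ hk hk1)

/-- `injOn_nodes`: Auxiliary step of this node's calculus, VERBATIM from the lens file (see the module docstring);
the statement is its type. [folklore] -/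
theorem injOn_nodes (h1 : (1 : E ≃+* E) ∈ H) (hmul : ∀ g ∈ H, ∀ h ∈ H, g * h ∈ H)
    (hHO : ∀ h ∈ H, ∀ z : E, z ∈ OE ↔ h z ∈ OE) {x : E}
    (hsep : ∀ h ∈ H, h ≠ 1 → OE.valuation (x - h x) = 1) :
    Set.InjOn (fun g : E ≃+* E => g x) (H : Set (E ≃+* E)) := by
  intro g hg h hh hgh
  by_contra hne
  have hv := valuation_sub_nodes_eq_one OE h1 hmul hHO hsep (Finset.mem_coe.mp hg)
    (Finset.mem_coe.mp hh) hne
  have : g x - h x = 0 := sub_eq_zero.mpr hgh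
  rw [this, map_zero] at hv
  exact zero_ne_one hv

/-- The Lagrange basis polynomials at the nodes `h x` have coefficients in the local ring `(T₁)_𝔪′`. [folklore] -/
theorem coeff_lagrangeBasis_mem (h1 : (1 : E ≃+* E) ∈ H) (hmul : ∀ g ∈ H, ∀ h ∈ H, g * h ∈ H)
    (hHO : ∀ h ∈ H, ∀ z : E, z ∈ OE ↔ h z ∈ OE) (hT₁H : ∀ h ∈ H, ∀ z ∈ T₁, h z ∈ T₁)
    {x : E} (hx : x ∈ T₁) (hsep : ∀ h ∈ H, h ≠ 1 → OE.valuation (x - h x) = 1)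
    [DecidableEq (E ≃+* E)] {g : E ≃+* E} (hg : g ∈ H) (i : ℕ) :
    (Lagrange.basis H (fun h : E ≃+* E => h x) g).coeff i ∈ locAtCentre T₁ OE := by
  set B₁ : Subring E := locAtCentre T₁ OE
  -- membership of the basis polynomial in the subring of polynomials with coefficients in `B₁`
  have hmem : Lagrange.basis H (fun h : E ≃+* E => h x) g ∈ Polynomial.liftsRing B₁.subtype := by
    rw [Lagrange.basis]
    refine prod_mem fun j hj => ?_
    have hjH : j ∈ H := Finset.mem_of_mem_erase hj
    have hjg : g ≠ j := fun e => (Finset.mem_erase.mp hj).1 e.symm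
    rw [Lagrange.basisDivisor]
    refine mul_mem ?_ (sub_mem ?_ ?_)
    · have hunit : OE.valuation (g x - j x) = 1 :=
        valuation_sub_nodes_eq_one OE h1 hmul hHO hsep hg hjH hjg
      have hdiff : g x - j x ∈ B₁ :=
        le_locAtCentre T₁ OE (T₁.sub_mem (hT₁H g hg x hx) (hT₁H j hjH x hx))
      have hinv : (g x - j x)⁻¹ ∈ B₁ := inv_mem_locAtCentre hdiff hunit
      have := Polynomial.C_mem_lifts B₁.subtype ⟨_, hinv⟩
      rw [Polynomial.lifts_iff_liftsRing] at this
      exact this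
    · have := Polynomial.X_mem_lifts B₁.subtype
      rw [Polynomial.lifts_iff_liftsRing] at this
      exact this
    · have hjx : j x ∈ B₁ := le_locAtCentre T₁ OE (hT₁H j hjH x hx)
      have := Polynomial.C_mem_lifts B₁.subtype ⟨_, hjx⟩
      rw [Polynomial.lifts_iff_liftsRing] at this
      exact this
  rw [← Polynomial.lifts_iff_liftsRing, Polynomial.lifts_iff_coeff_lifts] at hmem
  obtain ⟨c, hc⟩ := hmem i
  rw [← hc]
  exact c.2

end Lagrange

/-! ### S9. The maximal ideal upstairs is extended from the invariant local ring -/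

section Unramified

variable (H : Finset (E ≃+* E)) (K : Subfield E) (T₁ : Subring E)

/-- **UNRAMIFIEDNESS OF THE INVARIANT DESCENT (elementwise).**  Under the frame of part 1 plus `H`-stability
of `O_E`: every `b ∈ (T₁)_𝔪′` with `v(b) < 1` is `∑_{i < n} r_i c_i` with `r_i ∈ (T₁ ∩ K)_𝔪`, `v(r_i) < 1`,
`c_i ∈ (T₁)_𝔪′` (in fact `c_i = x^i / s`).  [folklore: a standard-étale extension of local rings is
unramified; here by Lagrange interpolation at the conjugates of the witness] [folklore] -/
theorem exists_sum_of_valuation_lt_one (h1 : (1 : E ≃+* E) ∈ H)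
    (hmul : ∀ g ∈ H, ∀ h ∈ H, g * h ∈ H) (hK : ∀ z, z ∈ K ↔ ∀ h ∈ H, h z = z)
    (hHO : ∀ h ∈ H, ∀ z : E, z ∈ OE ↔ h z ∈ OE)
    (hT₁O : T₁ ≤ OE.toSubring) (hT₁H : ∀ h ∈ H, ∀ z ∈ T₁, h z ∈ T₁)
    {x : E} (hx : x ∈ T₁) (hsep : ∀ h ∈ H, h ≠ 1 → OE.valuation (x - h x) = 1)
    (hgen : ∀ z : E, ∃ p : E[X], (∀ i, p.coeff i ∈ K) ∧ z = p.eval x)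
    {b : E} (hb : b ∈ locAtCentre T₁ OE) (hbv : OE.valuation b < 1) :
    ∃ (n : ℕ) (r c : ℕ → E),
      (∀ i, r i ∈ locAtCentre (T₁ ⊓ K.toSubring) OE ∧ OE.valuation (r i) < 1 ∧
        c i ∈ locAtCentre T₁ OE) ∧
      b = ∑ i ∈ Finset.range n, r i * c i := by
  classical
  set B₁ : Subring E := locAtCentre T₁ OE with hB₁
  have hB₁O : B₁ ≤ OE.toSubring := locAtCentre_le hT₁O
  obtain ⟨a, ha, s, hs, hsv, rfl⟩ := mem_locAtCentre_iff.mp hb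
  have hs0 : s ≠ 0 := ne_zero_of_valuation_eq_one hsv
  -- `v(a) < 1`
  have hav : OE.valuation a < 1 := by
    have : OE.valuation (a / s) = OE.valuation a := by rw [map_div₀, hsv, div_one]
    rwa [this] at hbv
  -- `a = R(x)`, `deg R < |H|`, coefficients `H`-fixed
  obtain ⟨p, hpK, hpa⟩ := hgen a
  have hpfix : ∀ h ∈ H, ∀ i, h (p.coeff i) = p.coeff i := fun h hh i => (hK _).mp (hpK i) h hh
  obtain ⟨R, hRdeg, hRfix, hRa⟩ := exists_eval_eq_of_degree_lt H h1 hmul x hpfix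
  rw [← hpa] at hRa
  -- Lagrange: `R = ∑_h C (R (h x)) * ℓ_h`
  have hinj := injOn_nodes OE h1 hmul hHO hsep (x := x)
  have hReq := Lagrange.eq_interpolate (f := R) hinj hRdeg
  -- the coefficients of `R`
  have hcoeff : ∀ i, R.coeff i =
      ∑ h ∈ H, R.eval (h x) * (Lagrange.basis H (fun g : E ≃+* E => g x) h).coeff i := by
    intro i
    conv_lhs => rw [hReq]
    rw [Lagrange.interpolate_apply, finsetSum_coeff]
    refine Finset.sum_congr rfl fun h _ => ?_
    rw [coeff_C_mul]
  have hRval : ∀ h ∈ H, R.eval (h x) = h a := fun h hh => by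
    rw [← apply_eval_of_coeff_fixed h (hRfix h hh) x, hRa]
  -- each coefficient lies in `B₁`, has value `< 1`, and is `H`-fixed, hence lies in `(T₁ ∩ K)_𝔪`
  have hrB₁ : ∀ i, R.coeff i ∈ B₁ := fun i => by
    rw [hcoeff i]
    refine B₁.sum_mem fun h hh => B₁.mul_mem ?_ ?_
    · rw [hRval h hh]; exact le_locAtCentre T₁ OE (hT₁H h hh a ha)
    · exact coeff_lagrangeBasis_mem OE h1 hmul hHO hT₁H hx hsep hh i
  have hrv : ∀ i, OE.valuation (R.coeff i) < 1 := fun i => by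
    rw [hcoeff i]
    refine Valuation.map_sum_lt _ one_ne_zero fun h hh => ?_
    rw [map_mul, hRval h hh]
    have hc1 : OE.valuation ((Lagrange.basis H (fun g : E ≃+* E => g x) h).coeff i) ≤ 1 :=
      (OE.valuation_le_one_iff _).mpr (hB₁O (coeff_lagrangeBasis_mem OE h1 hmul hHO hT₁H hx hsep hh i))
    calc OE.valuation (h a) * OE.valuation _ ≤ OE.valuation (h a) * 1 := mul_le_mul' le_rfl hc1
      _ = OE.valuation (h a) := mul_one _
      _ < 1 := valuation_apply_lt_one OE (hHO h hh) hav
  have hrB : ∀ i, R.coeff i ∈ locAtCentre (T₁ ⊓ K.toSubring) OE := fun i =>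
    mem_locAtCentre_inf_of_fixed OE h1 hmul hK hT₁O hT₁H (hrB₁ i) fun h hh => hRfix h hh i
  -- assemble `a / s = ∑ r_i (x^i / s)`
  refine ⟨R.natDegree + 1, fun i => R.coeff i, fun i => x ^ i / s, fun i => ⟨hrB i, hrv i, ?_⟩, ?_⟩
  · exact mem_locAtCentre_iff.mpr ⟨x ^ i, T₁.pow_mem hx i, s, hs, hsv, rfl⟩
  · rw [← hRa, eval_eq_sum_range, Finset.sum_div]
    refine Finset.sum_congr rfl fun i _ => ?_
    rw [mul_div_assoc]

/-- **UNRAMIFIEDNESS OF THE INVARIANT DESCENT (ideal form).**  `𝔪_{(T₁)_𝔪′}` is the extension of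
`𝔪_{(T₁ ∩ K)_𝔪}` along the inclusion `(T₁ ∩ K)_𝔪 ⊆ (T₁)_𝔪′`. [folklore] -/
theorem maximalIdeal_locAtCentre_eq_map (h1 : (1 : E ≃+* E) ∈ H)
    (hmul : ∀ g ∈ H, ∀ h ∈ H, g * h ∈ H) (hK : ∀ z, z ∈ K ↔ ∀ h ∈ H, h z = z)
    (hHO : ∀ h ∈ H, ∀ z : E, z ∈ OE ↔ h z ∈ OE)
    (hT₁O : T₁ ≤ OE.toSubring) (hT₁H : ∀ h ∈ H, ∀ z ∈ T₁, h z ∈ T₁)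
    {x : E} (hx : x ∈ T₁) (hsep : ∀ h ∈ H, h ≠ 1 → OE.valuation (x - h x) = 1)
    (hgen : ∀ z : E, ∃ p : E[X], (∀ i, p.coeff i ∈ K) ∧ z = p.eval x) :
    (haveI := isLocalRing_locAtCentre hT₁O
     haveI := isLocalRing_locAtCentre ((inf_le_left : T₁ ⊓ K.toSubring ≤ T₁).trans hT₁O)
     IsLocalRing.maximalIdeal (locAtCentre T₁ OE) =
       Ideal.map (Subring.inclusion (locAtCentre_mono OE (inf_le_left : T₁ ⊓ K.toSubring ≤ T₁)))
         (IsLocalRing.maximalIdeal (locAtCentre (T₁ ⊓ K.toSubring) OE))) := by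
  haveI := isLocalRing_locAtCentre hT₁O
  have hTO : T₁ ⊓ K.toSubring ≤ OE.toSubring := (inf_le_left : T₁ ⊓ K.toSubring ≤ T₁).trans hT₁O
  haveI := isLocalRing_locAtCentre hTO
  apply le_antisymm
  · intro b hb
    have hbv := (mem_maximalIdeal_locAtCentre_iff hT₁O b).mp hb
    obtain ⟨n, r, c, hrc, hsum⟩ :=
      exists_sum_of_valuation_lt_one OE H K T₁ h1 hmul hK hHO hT₁O hT₁H hx hsep hgen b.2 hbv
    have hb' : b = ∑ i ∈ Finset.range n,
        Subring.inclusion (locAtCentre_mono OE (inf_le_left : T₁ ⊓ K.toSubring ≤ T₁))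
            ⟨r i, (hrc i).1⟩ * (⟨c i, (hrc i).2.2⟩ : locAtCentre T₁ OE) := by
      apply Subtype.ext
      rw [hsum]
      simp
    rw [hb']
    refine Ideal.sum_mem _ fun i _ => Ideal.mul_mem_right _ _ (Ideal.mem_map_of_mem _ ?_)
    exact (mem_maximalIdeal_locAtCentre_iff hTO _).mpr (hrc i).2.1
  · rw [Ideal.map_le_iff_le_comap]
    intro m hm
    have hmv := (mem_maximalIdeal_locAtCentre_iff hTO m).mp hm
    exact (mem_maximalIdeal_locAtCentre_iff hT₁O _).mpr hmv

end Unramified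

end Summit.ResolutionOfSingularities.ResolutionOfSingularities.Theorems.InvariantDescentLU
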